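import Summits.BirchSwinnertonDyer.BirchSwinnertonDyer.Theorems.ThetaPartnerAtTwoSignedMainConjectureCMTwoRankZeroFlatTwistHecke
import HarnessLib

/-!
# Route `ThetaPartnerAtTwo`, crux K2r0P `SignedMainConjectureCMTwoRankZeroOfPub` (stmt-BirchSwinnertonDyer-24945),
# line `rankzero` v14, stub (μ♭)_A: the Jacobi-twisted Hecke sum at a COMPOSITE modulus, modulo 2 — Chinese
# remainder for the symbol sums and the multiplicativity `S_{ab} = S_a · S_b` of the dilation sets (the recursion step)

Cell `bsd-wall`, width seat `bsd-wall-tp2-p2-w3` (g2). THEOREMS ONLY (no `def`, no named fact, no `sorry`); pure modular-symbol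
algebra for ONE rational newform `g` of level `N`; sequel of `…FlatTwistHecke` (p614468, the prime modulus); helper `--supports`
the crux; BSD is not proved by any of this.

For a modulus `m` prime to `N` write the JACOBI-TWISTED SUM of doubled symbol differences
`T_m(x) = ∑_{u mod m} (u/m)·(2[x + u/m]⁺_g − 2[u/m]⁺_g)` (`(u/m)` the Jacobi symbol — the weight in Birch's lemma for the
quadratic twist by a square-free `d` with `|d| = m`, tree `exists_ratPlusSymbol_twist_eq_sum_and_sq`) and `I(y) = 2([y]⁺_g − [0]⁺_g) ∈ ℤ`.

* §1 `sum_zmod_mul_eq_sum_sum` — Chinese remainder for sums: for coprime `a, b`, `u ↦ (w, v)` with `u ≡ w·b + v·a (mod ab)`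
  is a bijection `ℤ/ab ≃ ℤ/a × ℤ/b`, and `u/(ab) ≡ w/a + v/b (mod 1)` (`ratPlusSymbol_add_crt`).
* §2 `jacobiSym_crt` — `((wb + va)/ab) = (b/a)(a/b)·(w/a)·(v/b)`; `sum_jacobi_mul_dilate` — re-indexing `v ↦ tv` of a
  `(v/b)`-weighted sum by a unit `t` costs the sign `(t/b)`.
* §3 **`exists_int_twistedSum_mul`** — THE RECURSION: if `T_a(y) ≡ ∑_{t∈S_a} I(ty)` and `T_b(y) ≡ ∑_{t'∈S_b} I(t'y) (mod 2ℤ)` for all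
  `y` with `den y` prime to `N` (`S_a ∣ a²` pointwise, `(a,b) = (a,N) = (b,N) = 1`), then `T_{ab}(x) ≡ ∑_{(t,t')∈S_a×S_b} I(tt'x) (mod 2ℤ)`
  — all signs `(b/a)(a/b)`, `(t/b)` are `±1 ≡ 1`.
The sequel `…FlatTwistComposite` runs the induction on the primes of a SQUARE-FREE `m` (base: `…FlatTwistHecke`'s prime case,
`S_ℓ = {1, ℓ²}` or `{1, ℓ, ℓ²}` by the parity of `a_ℓ(g)`; step: §3 with `S_{ℓm} = S_ℓ·S_m`) and feeds the resulting dilation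
set `S_m ⊆ {divisors of m²}` into the twist transport of FLAT for every square-free `d > 0`, `d ≡ 1 (mod 4)`.

References: B. Mazur, J. Tate, J. Teitelbaum, Invent. Math. 84 (1986) §I.4 (4.2), §I.8 [MazurTateTeitelbaum1986Invent];
K. Ireland, M. Rosen, GTM 84, Prop. 5.2.2 (Jacobi symbol) [IrelandRosen1990]; M. Emerton, R. Pollack, T. Weston, Invent. Math.
163 (2006) Lemma 4.4.4 [EmertonPollackWeston2006].
-/

set_option autoImplicit false
-- the Theorems namespace of this sub repeats the summit name by design (D-0017 nested layout)
set_option linter.dupNamespace false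

noncomputable section

open scoped Classical MatrixGroups ModularForm NumberTheorySymbols

open CongruenceSubgroup Literature.NumberTheory.EllipticCurves Literature.NumberTheory.EllipticCurves.ModularForms

namespace Summit.BirchSwinnertonDyer.BirchSwinnertonDyer.Theorems.FlatTwist

/-! ## §1. Chinese remainder for sums over `ℤ/ab` and for the cusps `u/(ab)` -/

section CRT

variable {a b : ℕ} [NeZero a] [NeZero b]

omit [NeZero b] in
/-- The residue of `w·b + v·a` modulo `a` is `w·b`. [folklore] -/
theorem natCast_crt_zmod_left (w : ZMod a) (v : ZMod b) :
    (((w.val * b + v.val * a : ℕ)) : ZMod a) = w * (b : ZMod a) := by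
  push_cast
  rw [ZMod.natCast_zmod_val, ZMod.natCast_self, mul_zero, add_zero]

omit [NeZero a] in
/-- The residue of `w·b + v·a` modulo `b` is `v·a`. [folklore] -/
theorem natCast_crt_zmod_right (w : ZMod a) (v : ZMod b) :
    (((w.val * b + v.val * a : ℕ)) : ZMod b) = v * (a : ZMod b) := by
  push_cast
  rw [ZMod.natCast_zmod_val, ZMod.natCast_self, mul_zero, zero_add]

/-- **Chinese remainder for sums**: for coprime `a, b`, summing over `ℤ/ab` is summing over pairs `(w, v) ∈ ℤ/a × ℤ/b` through
`u = w·b + v·a`. [folklore] -/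
theorem sum_zmod_mul_eq_sum_sum (hab : a.Coprime b) (F : ZMod (a * b) → ℚ) :
    ∑ u : ZMod (a * b), F u = ∑ w : ZMod a, ∑ v : ZMod b, F (((w.val * b + v.val * a : ℕ)) : ZMod (a * b)) := by
  haveI : NeZero (a * b) := ⟨mul_ne_zero (NeZero.ne a) (NeZero.ne b)⟩
  set φ : ZMod a × ZMod b → ZMod (a * b) := fun q ↦ (((q.1.val * b + q.2.val * a : ℕ)) : ZMod (a * b)) with hφ
  have hinj : Function.Injective φ := by
    rintro ⟨w₁, v₁⟩ ⟨w₂, v₂⟩ h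
    simp only [hφ] at h
    have ha : (((w₁.val * b + v₁.val * a : ℕ)) : ZMod a) = (((w₂.val * b + v₂.val * a : ℕ)) : ZMod a) := by
      have h' := congrArg (ZMod.castHom (dvd_mul_right a b) (ZMod a)) h
      simpa only [map_natCast] using h'
    have hb : (((w₁.val * b + v₁.val * a : ℕ)) : ZMod b) = (((w₂.val * b + v₂.val * a : ℕ)) : ZMod b) := by
      have h' := congrArg (ZMod.castHom (dvd_mul_left b a) (ZMod b)) h
      simpa only [map_natCast] using h'
    rw [natCast_crt_zmod_left, natCast_crt_zmod_left] at ha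
    rw [natCast_crt_zmod_right, natCast_crt_zmod_right] at hb
    have hub : (b : ZMod a) = ((ZMod.unitOfCoprime b hab.symm : (ZMod a)ˣ) : ZMod a) := (ZMod.coe_unitOfCoprime b hab.symm).symm
    have hua : (a : ZMod b) = ((ZMod.unitOfCoprime a hab : (ZMod b)ˣ) : ZMod b) := (ZMod.coe_unitOfCoprime a hab).symm
    rw [hub, Units.mul_left_inj] at ha
    rw [hua, Units.mul_left_inj] at hb
    exact Prod.ext ha hb
  have hbij : Function.Bijective φ := by
    rw [Fintype.bijective_iff_injective_and_card]
    exact ⟨hinj, by simp [ZMod.card, Fintype.card_prod]⟩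
  rw [← Fintype.sum_bijective φ hbij (fun q ↦ F (φ q)) F (fun _ ↦ rfl), Fintype.sum_prod_type]

variable {N : ℕ} [NeZero N] (g : CuspForm (Gamma0 N) 2)

omit [NeZero a] [NeZero b] in
/-- `[x + (n mod m)/m]⁺ = [x + n/m]⁺` (the symbol is `1`-periodic). [cite: MazurTateTeitelbaum1986Invent, §I.4] -/
theorem ratPlusSymbol_add_val_natCast_div (x : ℚ) {m : ℕ} [NeZero m] (n : ℕ) :
    ratPlusSymbol g (x + (((n : ZMod m)).val : ℚ) / m) = ratPlusSymbol g (x + (n : ℚ) / m) := by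
  have hm : (m : ℚ) ≠ 0 := by exact_mod_cast (NeZero.ne m)
  rw [ZMod.val_natCast]
  have hdiv : (n : ℚ) / m = ((n % m : ℕ) : ℚ) / m + ((n / m : ℕ) : ℚ) := by
    have h' : (n : ℚ) = ((n % m : ℕ) : ℚ) + (m : ℚ) * ((n / m : ℕ) : ℚ) := by
      exact_mod_cast (Nat.mod_add_div n m).symm
    rw [h']
    field_simp
  have hper := ratPlusSymbol_add_intCast_eq g (x + ((n % m : ℕ) : ℚ) / m) ((n / m : ℕ) : ℤ)
  rw [Int.cast_natCast] at hper
  rw [hdiv, ← add_assoc, hper]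

/-- **The cusp `(wb + va)/(ab)` is `w/a + v/b`** on plus symbols: `[x + u/(ab)]⁺ = [x + w/a + v/b]⁺` for `u ≡ wb + va (mod ab)`.
[cite: MazurTateTeitelbaum1986Invent, §I.4] -/
theorem ratPlusSymbol_add_crt (x : ℚ) (w : ZMod a) (v : ZMod b) :
    ratPlusSymbol g (x + (((((w.val * b + v.val * a : ℕ)) : ZMod (a * b))).val : ℚ) / ((a * b : ℕ) : ℚ)) =
      ratPlusSymbol g (x + (w.val : ℚ) / a + (v.val : ℚ) / b) := by
  haveI : NeZero (a * b) := ⟨mul_ne_zero (NeZero.ne a) (NeZero.ne b)⟩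
  have ha : (a : ℚ) ≠ 0 := by exact_mod_cast (NeZero.ne a)
  have hb : (b : ℚ) ≠ 0 := by exact_mod_cast (NeZero.ne b)
  rw [ratPlusSymbol_add_val_natCast_div]
  congr 1
  push_cast
  field_simp
  ring

end CRT

/-! ## §2. The Jacobi weight under Chinese remainder and under dilation -/

section Jacobi

variable {a b : ℕ} [NeZero a] [NeZero b]

/-- **`((wb + va)/ab) = (w/a)(b/a)·(v/b)(a/b)`** (multiplicativity of the Jacobi symbol in both arguments, periodicity in the top).
[cite: IrelandRosen1990, Prop. 5.2.2] -/
theorem jacobiSym_crt (w : ZMod a) (v : ZMod b) :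
    J(((w.val * b + v.val * a : ℕ) : ℤ) | a * b) = (J((w.val : ℤ) | a) * J((b : ℤ) | a)) * (J((v.val : ℤ) | b) * J((a : ℤ) | b)) := by
  rw [jacobiSym.mul_right]
  congr 1
  · rw [← jacobiSym.mul_left]
    refine jacobiSym.mod_left' ?_
    push_cast
    rw [Int.add_mul_emod_self_right]
  · rw [← jacobiSym.mul_left]
    refine jacobiSym.mod_left' ?_
    push_cast
    rw [add_comm, Int.add_mul_emod_self_right]

/-- `(u/b)` only depends on `u mod b`: for `u : ZMod b` and `t : ℕ`, `((t·u).val / b) = (t/b)·(u.val/b)`.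
[cite: IrelandRosen1990, Prop. 5.2.2] -/
theorem jacobiSym_val_natCast_mul (t : ℕ) (u : ZMod b) :
    J(((((t : ZMod b) * u).val : ℕ) : ℤ) | b) = J((t : ℤ) | b) * J((u.val : ℤ) | b) := by
  rw [← jacobiSym.mul_left]
  refine jacobiSym.mod_left' ?_
  have h : (((((t : ZMod b) * u).val : ℕ) : ℤ) : ZMod b) = (((t : ℤ) * (u.val : ℤ) : ℤ) : ZMod b) := by
    push_cast
    rw [ZMod.natCast_zmod_val, ZMod.natCast_zmod_val]
  exact (ZMod.intCast_eq_intCast_iff' _ _ _).mp h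

/-- **Dilating a `(v/b)`-weighted sum by a unit `t` costs the sign `(t/b)`**: for `G : ℕ → ℚ` that is `b`-periodic,
`∑_v (v/b)·G(t·v) = (t/b)·∑_u (u/b)·G(u)`. [cite: IrelandRosen1990, Prop. 5.2.2] -/
theorem sum_jacobi_mul_dilate {t : ℕ} (ht : t.Coprime b) (G : ℕ → ℚ) :
    ∑ v : ZMod b, (J((v.val : ℤ) | b) : ℚ) * G (((t : ZMod b) * v).val) =
      (J((t : ℤ) | b) : ℚ) * ∑ u : ZMod b, (J((u.val : ℤ) | b) : ℚ) * G u.val := by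
  have ht1 : J((t : ℤ) | b) ^ 2 = 1 := jacobiSym.sq_one (by rw [Int.gcd_natCast_natCast]; exact ht)
  -- rewrite the weight `(v/b) = (t/b)·((tv)/b)`
  have htt : (J((t : ℤ) | b) : ℚ) * J((t : ℤ) | b) = 1 := by
    have h : J((t : ℤ) | b) * J((t : ℤ) | b) = 1 := by rw [← sq]; exact ht1
    exact_mod_cast h
  have hw : ∀ v : ZMod b, (J((v.val : ℤ) | b) : ℚ) = (J((t : ℤ) | b) : ℚ) * J(((((t : ZMod b) * v).val : ℕ) : ℤ) | b) := by
    intro v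
    rw [jacobiSym_val_natCast_mul]
    push_cast
    rw [← mul_assoc, htt, one_mul]
  -- `v ↦ t·v` is a bijection of `ZMod b`
  set τ : (ZMod b)ˣ := ZMod.unitOfCoprime t ht with hτ
  have hτt : ((τ : (ZMod b)ˣ) : ZMod b) = (t : ZMod b) := ZMod.coe_unitOfCoprime t ht
  have hbij : Function.Bijective (fun v : ZMod b ↦ (t : ZMod b) * v) := by
    rw [← hτt]; exact τ.mulLeft_bijective
  calc ∑ v : ZMod b, (J((v.val : ℤ) | b) : ℚ) * G (((t : ZMod b) * v).val)
      = ∑ v : ZMod b, (J((t : ℤ) | b) : ℚ) *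
          ((J(((((t : ZMod b) * v).val : ℕ) : ℤ) | b) : ℚ) * G (((t : ZMod b) * v).val)) :=
        Finset.sum_congr rfl fun v _ ↦ by rw [hw v, mul_assoc]
    _ = (J((t : ℤ) | b) : ℚ) * ∑ v : ZMod b,
          (J(((((t : ZMod b) * v).val : ℕ) : ℤ) | b) : ℚ) * G (((t : ZMod b) * v).val) := by rw [Finset.mul_sum]
    _ = (J((t : ℤ) | b) : ℚ) * ∑ u : ZMod b, (J((u.val : ℤ) | b) : ℚ) * G u.val := by
        congr 1
        exact Fintype.sum_bijective _ hbij
          (fun v ↦ (J(((((t : ZMod b) * v).val : ℕ) : ℤ) | b) : ℚ) * G (((t : ZMod b) * v).val))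
          (fun u ↦ (J((u.val : ℤ) | b) : ℚ) * G u.val) (fun _ ↦ rfl)

end Jacobi

/-! ## §3. The recursion `T_{ab} ≡ ∑_{t∈S_a} ∑_{t'∈S_b} I(tt'·)` -/

section Recursion

variable {N : ℕ} [NeZero N] (g : CuspForm (Gamma0 N) 2)

omit [NeZero N] in
/-- `J((n mod m) | m) = J(n | m)`. [cite: IrelandRosen1990, Prop. 5.2.2] -/
theorem jacobiSym_val_natCast (m n : ℕ) [NeZero m] : J((((n : ZMod m)).val : ℤ) | m) = J((n : ℤ) | m) := by
  refine jacobiSym.mod_left' ?_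
  rw [ZMod.val_natCast, Int.natCast_mod, Int.emod_emod_of_dvd _ (dvd_refl _)]

omit [NeZero N] in
/-- A `±1`-valued integer is odd. [folklore] -/
theorem odd_of_eq_one_or_eq_neg_one {c : ℤ} (h : c = 1 ∨ c = -1) : Odd c := by
  rcases h with rfl | rfl <;> decide

omit [NeZero N] in
/-- **Parity bookkeeping**: a sum `∑_p c_p·i_p + 2r` with all `c_p` ODD integers is `∑_p i_p` modulo `2ℤ`. [folklore] -/
theorem exists_int_sum_oddMul_eq {ι : Type*} (T : Finset ι) (c i : ι → ℤ) (hc : ∀ p ∈ T, Odd (c p)) (r : ℤ) :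
    ∃ z : ℤ, ((∑ p ∈ T, c p * i p : ℤ) : ℚ) + 2 * r = (∑ p ∈ T, i p : ℤ) + 2 * z := by
  have hev : Even (∑ p ∈ T, (c p - 1) * i p) :=
    Finset.even_sum _ fun p hp ↦ ((hc p hp).sub_odd odd_one).mul_right _
  obtain ⟨w, hw⟩ := hev
  refine ⟨w + r, ?_⟩
  have h : (∑ p ∈ T, c p * i p : ℤ) = ∑ p ∈ T, i p + ∑ p ∈ T, (c p - 1) * i p := by
    rw [← Finset.sum_add_distrib]
    exact Finset.sum_congr rfl fun p _ ↦ by ring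
  rw [h, hw]
  push_cast
  ring

/-- **THE RECURSION.** Let `g` be a normalised newform of level `N` with rational coefficients, `a, b ≥ 1` coprime to each other and
to `N`, and suppose the Jacobi-twisted sums at the moduli `a` and `b` are known modulo `2ℤ` on the cusps with denominator prime to
`N`: `T_a(y) = ∑_{t∈S_a} I(ty) + 2ℤ` (`S_a` a finite set of divisors of `a²`) and `T_b(y) = ∑_{t'∈S_b} I(t'y) + 2ℤ`. Then
`T_{ab}(x) = ∑_{(t,t')∈S_a×S_b} I(tt'x) + 2ℤ` for every `x` with `den x` prime to `N`. Proof: Chinese remainder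
`u ≡ wb + va`, `(u/ab) = ±(w/a)(v/b)`, `[x + u/ab] = [x + w/a + v/b]`; the inner `w`-sum is `T_a(x + v/b) − T_a(v/b)`; each
resulting `v`-sum `∑_v (v/b)(I(tx + tv/b) − I(tv/b))` is `(t/b)·T_b(tx)` after `v ↦ tv`; all signs are `±1 ≡ 1 (mod 2)`.
[cite: MazurTateTeitelbaum1986Invent, §I.4 (4.2) and §I.8] [cite: IrelandRosen1990, Prop. 5.2.2] -/
theorem exists_int_twistedSum_mul (hQ : coeffField g = ⊥) {a b : ℕ} [NeZero a] [NeZero b]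
    (hab : a.Coprime b) (hbN : b.Coprime N)
    (Sa Sb : Finset ℕ) (hSa : ∀ t ∈ Sa, t ∣ a ^ 2)
    (hQa : ∀ y : ℚ, y.den.Coprime N → ∃ z : ℤ,
      ∑ u : ZMod a, (J((u.val : ℤ) | a) : ℚ) *
          (2 * ratPlusSymbol g (y + (u.val : ℚ) / a) - 2 * ratPlusSymbol g ((u.val : ℚ) / a)) =
        ∑ t ∈ Sa, 2 * (ratPlusSymbol g ((t : ℚ) * y) - ratPlusSymbol g 0) + 2 * z)
    (hQb : ∀ y : ℚ, y.den.Coprime N → ∃ z : ℤ,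
      ∑ u : ZMod b, (J((u.val : ℤ) | b) : ℚ) *
          (2 * ratPlusSymbol g (y + (u.val : ℚ) / b) - 2 * ratPlusSymbol g ((u.val : ℚ) / b)) =
        ∑ t ∈ Sb, 2 * (ratPlusSymbol g ((t : ℚ) * y) - ratPlusSymbol g 0) + 2 * z)
    {x : ℚ} (hx : x.den.Coprime N) :
    ∃ z : ℤ, ∑ u : ZMod (a * b), (J((u.val : ℤ) | a * b) : ℚ) *
        (2 * ratPlusSymbol g (x + (u.val : ℚ) / ((a * b : ℕ) : ℚ)) - 2 * ratPlusSymbol g ((u.val : ℚ) / ((a * b : ℕ) : ℚ))) =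
      ∑ p ∈ Sa ×ˢ Sb, 2 * (ratPlusSymbol g (((p.1 * p.2 : ℕ) : ℚ) * x) - ratPlusSymbol g 0) + 2 * z := by
  haveI : NeZero (a * b) := ⟨mul_ne_zero (NeZero.ne a) (NeZero.ne b)⟩
  have hreal : ∀ n, (cuspCoeff g n).im = 0 := cuspCoeff_im_eq_zero_of_coeffField_eq_bot hQ
  have ha0 : (a : ℚ) ≠ 0 := by exact_mod_cast (NeZero.ne a)
  have hb0 : (b : ℚ) ≠ 0 := by exact_mod_cast (NeZero.ne b)
  set σ : ℤ := J((b : ℤ) | a) * J((a : ℤ) | b) with hσ_def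
  -- Step 1–2: Chinese remainder, term by term
  have hterm : ∀ (w : ZMod a) (v : ZMod b),
      (J((((((w.val * b + v.val * a : ℕ)) : ZMod (a * b))).val : ℤ) | a * b) : ℚ) *
        (2 * ratPlusSymbol g (x + (((((w.val * b + v.val * a : ℕ)) : ZMod (a * b))).val : ℚ) / ((a * b : ℕ) : ℚ)) -
          2 * ratPlusSymbol g ((((((w.val * b + v.val * a : ℕ)) : ZMod (a * b))).val : ℚ) / ((a * b : ℕ) : ℚ))) =
      (σ : ℚ) * ((J((v.val : ℤ) | b) : ℚ) * ((J((w.val : ℤ) | a) : ℚ) *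
        (2 * ratPlusSymbol g ((x + (v.val : ℚ) / b) + (w.val : ℚ) / a) -
          2 * ratPlusSymbol g ((v.val : ℚ) / b + (w.val : ℚ) / a)))) := by
    intro w v
    rw [jacobiSym_val_natCast, jacobiSym_crt, ratPlusSymbol_add_crt g x w v,
      ← zero_add ((((((w.val * b + v.val * a : ℕ)) : ZMod (a * b))).val : ℚ) / ((a * b : ℕ) : ℚ)),
      ratPlusSymbol_add_crt g 0 w v, zero_add, hσ_def]
    have e1 : x + (w.val : ℚ) / a + (v.val : ℚ) / b = (x + (v.val : ℚ) / b) + (w.val : ℚ) / a := by ring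
    have e2 : (w.val : ℚ) / a + (v.val : ℚ) / b = (v.val : ℚ) / b + (w.val : ℚ) / a := by ring
    rw [e1, e2]
    push_cast
    ring
  -- Step 3–4: the inner `w`-sum is `T_a(x + v/b) − T_a(v/b)`; apply `hQa` twice
  choose z₁ hz₁ using fun v : ZMod b ↦ hQa (x + (v.val : ℚ) / b) (coprime_den_add_natCast_div hx hbN v.val)
  choose z₀ hz₀ using fun v : ZMod b ↦ hQa ((v.val : ℚ) / b) (coprime_den_natCast_div hbN v.val)
  have hinner : ∀ v : ZMod b, ∑ w : ZMod a, (J((w.val : ℤ) | a) : ℚ) *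
      (2 * ratPlusSymbol g ((x + (v.val : ℚ) / b) + (w.val : ℚ) / a) -
        2 * ratPlusSymbol g ((v.val : ℚ) / b + (w.val : ℚ) / a)) =
      ∑ t ∈ Sa, (2 * ratPlusSymbol g ((t : ℚ) * x + ((t * v.val : ℕ) : ℚ) / b) -
        2 * ratPlusSymbol g (((t * v.val : ℕ) : ℚ) / b)) + 2 * ((z₁ v : ℚ) - z₀ v) := by
    intro v
    have hsplit : ∑ w : ZMod a, (J((w.val : ℤ) | a) : ℚ) *
        (2 * ratPlusSymbol g ((x + (v.val : ℚ) / b) + (w.val : ℚ) / a) -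
          2 * ratPlusSymbol g ((v.val : ℚ) / b + (w.val : ℚ) / a)) =
        ∑ w : ZMod a, (J((w.val : ℤ) | a) : ℚ) *
            (2 * ratPlusSymbol g ((x + (v.val : ℚ) / b) + (w.val : ℚ) / a) - 2 * ratPlusSymbol g ((w.val : ℚ) / a)) -
          ∑ w : ZMod a, (J((w.val : ℤ) | a) : ℚ) *
            (2 * ratPlusSymbol g ((v.val : ℚ) / b + (w.val : ℚ) / a) - 2 * ratPlusSymbol g ((w.val : ℚ) / a)) := by
      rw [← Finset.sum_sub_distrib]
      exact Finset.sum_congr rfl fun w _ ↦ by ring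
    rw [hsplit, hz₁ v, hz₀ v]
    have hts : ∑ t ∈ Sa, 2 * (ratPlusSymbol g ((t : ℚ) * (x + (v.val : ℚ) / b)) - ratPlusSymbol g 0) -
        ∑ t ∈ Sa, 2 * (ratPlusSymbol g ((t : ℚ) * ((v.val : ℚ) / b)) - ratPlusSymbol g 0) =
        ∑ t ∈ Sa, (2 * ratPlusSymbol g ((t : ℚ) * x + ((t * v.val : ℕ) : ℚ) / b) -
          2 * ratPlusSymbol g (((t * v.val : ℕ) : ℚ) / b)) := by
      rw [← Finset.sum_sub_distrib]
      refine Finset.sum_congr rfl fun t _ ↦ ?_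
      have e1 : (t : ℚ) * (x + (v.val : ℚ) / b) = (t : ℚ) * x + ((t * v.val : ℕ) : ℚ) / b := by push_cast; ring
      have e2 : (t : ℚ) * ((v.val : ℚ) / b) = ((t * v.val : ℕ) : ℚ) / b := by push_cast; ring
      rw [e1, e2]
      ring
    linear_combination hts
  -- Step 5–6: for each `t ∈ Sa`, `∑_v (v/b)·(2[tx + tv/b] − 2[tv/b]) = (t/b)·T_b(tx)`; apply `hQb`
  choose z₂ hz₂ using fun t : ℕ ↦ hQb ((t : ℚ) * x) (coprime_den_natCast_mul hx t)
  have hdil : ∀ t ∈ Sa, ∑ v : ZMod b, (J((v.val : ℤ) | b) : ℚ) *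
      (2 * ratPlusSymbol g ((t : ℚ) * x + ((t * v.val : ℕ) : ℚ) / b) - 2 * ratPlusSymbol g (((t * v.val : ℕ) : ℚ) / b)) =
      (J((t : ℤ) | b) : ℚ) * (∑ t' ∈ Sb, 2 * (ratPlusSymbol g ((t' : ℚ) * ((t : ℚ) * x)) - ratPlusSymbol g 0) + 2 * z₂ t) := by
    intro t ht
    have htb : t.Coprime b := Nat.Coprime.coprime_dvd_left (hSa t ht) (Nat.Coprime.pow_left 2 hab)
    -- periodicity: `t·v.val` may be replaced by `(t·v).val`
    have hper : ∀ v : ZMod b, 2 * ratPlusSymbol g ((t : ℚ) * x + ((t * v.val : ℕ) : ℚ) / b) -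
        2 * ratPlusSymbol g (((t * v.val : ℕ) : ℚ) / b) =
        2 * ratPlusSymbol g ((t : ℚ) * x + ((((t : ZMod b) * v).val : ℕ) : ℚ) / b) -
          2 * ratPlusSymbol g (((((t : ZMod b) * v).val : ℕ) : ℚ) / b) := by
      intro v
      have hc : ((t * v.val : ℕ) : ZMod b) = (t : ZMod b) * v := by push_cast; rw [ZMod.natCast_zmod_val]
      rw [← ratPlusSymbol_add_val_natCast_div g ((t : ℚ) * x) (t * v.val), hc,
        ← zero_add ((((t * v.val : ℕ) : ℚ)) / (b : ℚ)), ← ratPlusSymbol_add_val_natCast_div g 0 (t * v.val), hc, zero_add]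
    rw [Finset.sum_congr rfl fun v _ ↦ by rw [hper v]]
    rw [sum_jacobi_mul_dilate htb (fun n ↦ 2 * ratPlusSymbol g ((t : ℚ) * x + (n : ℚ) / b) - 2 * ratPlusSymbol g ((n : ℚ) / b)),
      hz₂ t]
  -- integers `I(tt'x)` and odd signs
  choose i hi using fun q : ℕ × ℕ ↦
    SignedMuAtTwo.exists_two_mul_ratPlusSymbol_sub_eq_intCast g hreal (coprime_den_natCast_mul hx (q.1 * q.2))
  have hσ : σ = 1 ∨ σ = -1 := by
    have h1 := jacobiSym.eq_one_or_neg_one (a := (b : ℤ)) (b := a) (by rw [Int.gcd_natCast_natCast]; exact hab.symm)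
    have h2 := jacobiSym.eq_one_or_neg_one (a := (a : ℤ)) (b := b) (by rw [Int.gcd_natCast_natCast]; exact hab)
    rcases h1 with h1 | h1 <;> rcases h2 with h2 | h2 <;> simp [hσ_def, h1, h2]
  have hcodd : ∀ q ∈ Sa ×ˢ Sb, Odd (σ * J((q.1 : ℤ) | b)) := by
    intro q hq
    have ht : q.1 ∈ Sa := (Finset.mem_product.mp hq).1
    have htb : q.1.Coprime b := Nat.Coprime.coprime_dvd_left (hSa q.1 ht) (Nat.Coprime.pow_left 2 hab)
    exact (odd_of_eq_one_or_eq_neg_one hσ).mul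
      (odd_of_eq_one_or_eq_neg_one (jacobiSym.eq_one_or_neg_one (by rw [Int.gcd_natCast_natCast]; exact htb)))
  -- Step 7: assemble into `∑_q c_q · i_q + 2r` with odd `c_q`
  set R₁ : ℤ := ∑ v : ZMod b, J((v.val : ℤ) | b) * (z₁ v - z₀ v) with hR₁
  set R₂ : ℤ := ∑ t ∈ Sa, J((t : ℤ) | b) * z₂ t with hR₂
  have hE : ∀ t t' : ℕ, 2 * (ratPlusSymbol g ((t' : ℚ) * ((t : ℚ) * x)) - ratPlusSymbol g 0) = (i (t, t') : ℚ) := by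
    intro t t'
    rw [← hi (t, t')]
    push_cast
    ring_nf
  have hmain : ∑ u : ZMod (a * b), (J((u.val : ℤ) | a * b) : ℚ) *
      (2 * ratPlusSymbol g (x + (u.val : ℚ) / ((a * b : ℕ) : ℚ)) - 2 * ratPlusSymbol g ((u.val : ℚ) / ((a * b : ℕ) : ℚ))) =
      ((∑ q ∈ Sa ×ˢ Sb, (σ * J((q.1 : ℤ) | b)) * i q : ℤ) : ℚ) + 2 * ((σ * (R₂ + R₁) : ℤ) : ℚ) := by
    calc _ = ∑ w : ZMod a, ∑ v : ZMod b, (σ : ℚ) * ((J((v.val : ℤ) | b) : ℚ) * ((J((w.val : ℤ) | a) : ℚ) *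
            (2 * ratPlusSymbol g ((x + (v.val : ℚ) / b) + (w.val : ℚ) / a) -
              2 * ratPlusSymbol g ((v.val : ℚ) / b + (w.val : ℚ) / a)))) := by
          rw [sum_zmod_mul_eq_sum_sum hab]
          exact Finset.sum_congr rfl fun w _ ↦ Finset.sum_congr rfl fun v _ ↦ hterm w v
      _ = ∑ v : ZMod b, ∑ w : ZMod a, (σ : ℚ) * ((J((v.val : ℤ) | b) : ℚ) * ((J((w.val : ℤ) | a) : ℚ) *
            (2 * ratPlusSymbol g ((x + (v.val : ℚ) / b) + (w.val : ℚ) / a) -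
              2 * ratPlusSymbol g ((v.val : ℚ) / b + (w.val : ℚ) / a)))) := Finset.sum_comm
      _ = ∑ v : ZMod b, (σ : ℚ) * ((J((v.val : ℤ) | b) : ℚ) *
            (∑ t ∈ Sa, (2 * ratPlusSymbol g ((t : ℚ) * x + ((t * v.val : ℕ) : ℚ) / b) -
              2 * ratPlusSymbol g (((t * v.val : ℕ) : ℚ) / b)) + 2 * ((z₁ v : ℚ) - z₀ v))) := by
          refine Finset.sum_congr rfl fun v _ ↦ ?_
          rw [← hinner v, Finset.mul_sum, Finset.mul_sum]
      _ = (σ : ℚ) * (∑ t ∈ Sa, ∑ v : ZMod b, (J((v.val : ℤ) | b) : ℚ) *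
              (2 * ratPlusSymbol g ((t : ℚ) * x + ((t * v.val : ℕ) : ℚ) / b) -
                2 * ratPlusSymbol g (((t * v.val : ℕ) : ℚ) / b))) +
            2 * ((σ : ℚ) * ∑ v : ZMod b, (J((v.val : ℤ) | b) : ℚ) * ((z₁ v : ℚ) - z₀ v)) := by
          have h1 : ∀ v : ZMod b, (σ : ℚ) * ((J((v.val : ℤ) | b) : ℚ) *
              (∑ t ∈ Sa, (2 * ratPlusSymbol g ((t : ℚ) * x + ((t * v.val : ℕ) : ℚ) / b) -
                2 * ratPlusSymbol g (((t * v.val : ℕ) : ℚ) / b)) + 2 * ((z₁ v : ℚ) - z₀ v))) =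
              (σ : ℚ) * ((J((v.val : ℤ) | b) : ℚ) *
                ∑ t ∈ Sa, (2 * ratPlusSymbol g ((t : ℚ) * x + ((t * v.val : ℕ) : ℚ) / b) -
                  2 * ratPlusSymbol g (((t * v.val : ℕ) : ℚ) / b))) +
              2 * ((σ : ℚ) * ((J((v.val : ℤ) | b) : ℚ) * ((z₁ v : ℚ) - z₀ v))) := fun v ↦ by ring
          rw [Finset.sum_congr rfl fun v _ ↦ h1 v, Finset.sum_add_distrib, ← Finset.mul_sum, ← Finset.mul_sum,
            ← Finset.mul_sum]
          congr 1
          congr 1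
          simp_rw [Finset.mul_sum]
          exact Finset.sum_comm
      _ = (σ : ℚ) * (∑ t ∈ Sa, (J((t : ℤ) | b) : ℚ) *
              (∑ t' ∈ Sb, 2 * (ratPlusSymbol g ((t' : ℚ) * ((t : ℚ) * x)) - ratPlusSymbol g 0) + 2 * z₂ t)) +
            2 * ((σ : ℚ) * ∑ v : ZMod b, (J((v.val : ℤ) | b) : ℚ) * ((z₁ v : ℚ) - z₀ v)) := by
          rw [Finset.sum_congr rfl fun t ht ↦ hdil t ht]
      _ = _ := by
          rw [Finset.sum_product, hR₁, hR₂]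
          push_cast
          simp only [hE, mul_add, Finset.mul_sum, Finset.sum_add_distrib]
          ring_nf
  rw [hmain]
  obtain ⟨z, hz⟩ := exists_int_sum_oddMul_eq (Sa ×ˢ Sb) (fun q ↦ σ * J((q.1 : ℤ) | b)) i hcodd (σ * (R₂ + R₁))
  refine ⟨z, ?_⟩
  rw [hz]
  congr 1
  push_cast
  refine Finset.sum_congr rfl fun q _ ↦ ?_
  have h := hi q
  push_cast at h
  exact h.symm

end Recursion

end Summit.BirchSwinnertonDyer.BirchSwinnertonDyer.Theorems.FlatTwist

end
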